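import Literature.Barriers.QuantumFields.FiniteTemperatureInfraredGaussMoments
import Literature.Barriers.QuantumFields.FiniteTemperatureInfraredPathSums
import Mathlib.MeasureTheory.Constructions.Pi
import Mathlib.MeasureTheory.Integral.Pi
import HarnessLib

/-!
# Borgs–Seiler's double-commutator bound as an explicit Gram kernel (the analytic core of
# Lemma III.6 of Commun. Math. Phys. 91 (1983))

Third of three support files for the proof of the named fact
`Literature.Barriers.QuantumFields.BorgsSeilerInfraredBoundExplicit` (Borgs–Seiler's explicit infrared
bound `(1 − cos p₁) Ĝ(p) ≤ (1 + 2χ(1)/J_E)^{L₀} − 1` for the Polyakov-loop two-point function).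
Everything here is finite-dimensional linear algebra and Gaussian integration on `ℝ^{2N²L₀|X|}`; there
are no lattices, no transfer operators and no named facts.

## The statement (theorem `integral_conj_rker_mul_rker`, the Gram kernel identity)

Let `X` be a finite set (transverse sites), `L₀ ≥ 1` (layers), `N` (colours), `J > 0`, and let
`a, b : X → Fin L₀ → Mat_N(ℂ)` be two matrix fields (the time-like link variables of two adjacent
spatial slices, embedded in `ℂ^{N²}`), `f(m) = tr(m 0 ⋯ m (L₀-1))` the loop function (traced Polyakov
loop) and `h : X → ℂ` smearing weights. For a Gaussian configuration `k` (one complex Gaussian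
`κ_ι`, real and imaginary parts independent `N(0, J)`, per complex matrix entry) put

  `r_k(b) = e^{-i⟨k,b⟩} Σ_x h_x [f(b_x − iκ_x/J) − f(b_x)]`   (`rker`).

Then (for `J ≠ 0`)

  `∫ conj r_k(a) · r_k(b) dγ_J(k) = e^{-J‖a−b‖²/2} ( Σ_x |h_x|² Ξ_J(a_x, b_x) − |Σ_x h_x (f(a_x) − f(b_x))|² )`

where `Ξ_J(p, q) = tr ∏ₜ (pₜ ⊗ q̄ₜ + (2/J)|ω⟩⟨ω|) − f(p) conj f(q)` (`Xi`, file
`FiniteTemperatureInfraredPathSums`), and (theorem `norm_Xi_le`) `|Ξ_J(p, q)| ≤ (1 + 2N/J)^{L₀} − 1`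
for unitary blocks. The left side is a GRAM KERNEL in `(a, b)`, hence positive semidefinite; the
prefactor `e^{-J‖a−b‖²/2}` is (up to a constant) the electric Boltzmann weight `exp(J Σ Re tr(aₜbₜ*))`
coupling two adjacent slices across a bond. Downstream (`FiniteTemperatureInfraredExplicitProofs`),
reflection positivity across that bond turns positive semidefiniteness of the kernel into
`⟨|Σ h_x (χ(P_{0,x}) − χ(P_{1,x}))|²⟩ ≤ Σ_x |h_x|² Re⟨Ξ⟩ ≤ ‖h‖² ((1 + 2N/J_E)^{L₀} − 1)`, which is
Borgs–Seiler's Lemma III.6 in the form (III.59).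

## Relation to the printed proof (§III.2, pp. 349–353)

Borgs–Seiler bound the double commutator `[L(h)*, [L(h), T]]` of the smeared Polyakov loop with the
Gaussian convolution `T` (the electric part of the transfer matrix in the spatial 1-direction) by
Cauchy–Schwarz over transverse sites ((III.38)–(III.41), (III.51)) and the conjugation identity
`T⁻¹ u T = u + (2/J)∂/∂ū` in the embedding `U(N) ⊂ ℂ^{N²}` ((III.47)–(III.48)), whose expansion
terminates at order `L₀` because `f` is multilinear ((III.49)–(III.53)); the terms are products of
Wilson loops bounded by `χ(1)^k` ((III.54)–(III.58)). The present file proves the same inequality as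
the IDENTITY "`Σ_x|h_x|² Y_x − [L*,[L,T]] = [L,T]* T⁻¹ [L,T] ≥ 0`" written out in Fourier (Gaussian)
variables `k`, where `T⁻¹` disappears: `[L,T]*T⁻¹[L,T]` becomes the Gram kernel of the explicit
feature `r_k`, the conjugation identity becomes the one-coordinate Gaussian computation of
`FiniteTemperatureInfraredGaussMoments` (contraction term `2Jαβ`), the termination of the expansion
is the path-sum expansion of the multilinear `f` (`integrand_eq_sum_prod`), and the regrouping of
the contractions into transfer matrices on `ℂ^N ⊗ ℂ^N` (`prod_integral_factor_eq`, `gaussM`) replaces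
the combinatorics of Fig. 1. No operator inverses, unbounded operators or `δ`-function limits
(p. 350–351) are needed.

## Contents

* `CIdx`, `MField`, `γ J`, `kapM`, `loopTr`, `tphase`, `emb`, `pairFactor`, `gaussM`, `gaussE`,
  and the general two-site computation `integral_tphase_mul_conj_loopTr_mul_loopTr`:
  `∫ e^{i⟨k,Δ⟩} conj f(a_x + ακ_x) f(b_y + βκ_y) dγ = e^{-J‖Δ‖²/2} tr ∏ₜ Mₜ` with
  `Mₜ = (b_yₜ + iJβΔ_yₜ) ⊗ conj(a_xₜ − iJαΔ_xₜ) + 2J ᾱβ [x = y] |ω⟩⟨ω|`.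
* `Xi`, `norm_Xi_le` (from the rank-one perturbation bound of `FiniteTemperatureInfraredPathSums`).
* `alpha0 = −i/J`, `Rsite`, `Rsum`, `rin`, `rker` and the Gram kernel identity
  `integral_conj_rker_mul_rker`.
* Bounds (`norm_rker_le`, `norm_conj_rker_mul_rker_le` with the integrable dominating function
  `gDom`, `integrable_gDom`) and joint continuity (`continuous_rker`) — the hypotheses of Fubini and of
  the abstract reflection-positivity lemma downstream.

References: C. Borgs, E. Seiler, *Lattice Yang–Mills theory at nonzero temperature and the
confinement problem*, Commun. Math. Phys. 91 (1983) 329–380, §III.2 (III.32)–(III.59), pp. 349–353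
(held; PDF page = printed − 328). [BorgsSeiler1983]
-/

noncomputable section

open MeasureTheory Complex ProbabilityTheory Matrix
open scoped ComplexConjugate Matrix Kronecker

namespace Literature.Barriers.QuantumFields.InfraredGaussian

/-! ### The multilinear Gaussian computation -/

section Multi

variable {X : Type*} [Fintype X] [DecidableEq X] {L₀ N : ℕ} [NeZero L₀]

/-- Coordinates of the Gaussian family: site, layer, matrix entry. [folklore] -/
abbrev CIdx (X : Type*) (L₀ N : ℕ) := X × Fin L₀ × Fin N × Fin N

/-- Matrix-valued fields on sites and layers. [folklore] -/
abbrev MField (X : Type*) (L₀ N : ℕ) := X → Fin L₀ → Matrix (Fin N) (Fin N) ℂ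

/-- The entry of a field at a coordinate. [folklore] -/
def MField.entry (a : MField X L₀ N) (ι : CIdx X L₀ N) : ℂ := a ι.1 ι.2.1 ι.2.2.1 ι.2.2.2

variable (J : NNReal)

/-- The Gaussian law: all coordinates independent complex Gaussians. [folklore] -/
def γ : Measure (CIdx X L₀ N → ℝ × ℝ) := Measure.pi fun _ => γ₂ J

/-- `γ J` is a probability measure. [folklore] -/
instance : IsProbabilityMeasure (γ (X := X) (L₀ := L₀) (N := N) J) := by
  unfold γ; infer_instance

variable {J}

/-- The complex Gaussian matrices `κ_x t` read off from a Gaussian configuration `k`. [folklore] -/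
def kapM (k : CIdx X L₀ N → ℝ × ℝ) : MField X L₀ N :=
  fun x t e e' => kapz (k (x, t, e, e'))

omit [Fintype X] [DecidableEq X] [NeZero L₀] in
/-- Entries of `κ`. [folklore] -/
@[simp] theorem kapM_entry (k : CIdx X L₀ N → ℝ × ℝ) (ι : CIdx X L₀ N) :
    (kapM k).entry ι = kapz (k ι) := rfl

/-- The loop function `f(m) = tr(m 0 m 1 ⋯ m (L₀-1))`. [folklore] -/
def loopTr (m : Fin L₀ → Matrix (Fin N) (Fin N) ℂ) : ℂ := (cycProd m).trace

/-- Total phase `e^{i⟨k, Δ⟩} = ∏_ι e^{i Re(κ_ι conj Δ_ι)}`. [folklore] -/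
def tphase (Δ : MField X L₀ N) (k : CIdx X L₀ N → ℝ × ℝ) : ℂ := ∏ ι, phase (Δ.entry ι) (k ι)

/-- The embedding of the layers into the coordinates along an index cycle `c` at the site `x₀`. [folklore] -/
def emb (x₀ : X) (c : Fin L₀ → Fin N) (t : Fin L₀) : CIdx X L₀ N := (x₀, t, c t, c (t + 1))

omit [Fintype X] [DecidableEq X] in
/-- `emb x₀ c` is injective (the layer is a component). [folklore] -/
theorem emb_injective (x₀ : X) (c : Fin L₀ → Fin N) : Function.Injective (emb x₀ c) := by
  intro s t h
  have := congrArg (fun ι : CIdx X L₀ N => ι.2.1) h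
  exact this

omit [Fintype X] in
/-- Membership in the image of `emb x₀ c`, as a decidable equation. [folklore] -/
theorem mem_image_emb_iff (x₀ : X) (c : Fin L₀ → Fin N) (ι : CIdx X L₀ N) :
    ι ∈ Finset.univ.image (emb x₀ c) ↔ ι = emb x₀ c ι.2.1 := by
  constructor
  · rintro h
    obtain ⟨t, -, rfl⟩ := Finset.mem_image.1 h
    rfl
  · intro h
    exact Finset.mem_image.2 ⟨ι.2.1, Finset.mem_univ _, h.symm⟩

omit [Fintype X] [DecidableEq X] in
/-- Expansion of the loop function of an affine Gaussian perturbation as a sum over index cycles of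
products over the coordinates. [folklore] -/
theorem loopTr_add_smul_kapM (b : MField X L₀ N) (β : ℂ) (y₀ : X) (k : CIdx X L₀ N → ℝ × ℝ) :
    loopTr (fun t => b y₀ t + β • kapM k y₀ t) =
      ∑ c : Fin L₀ → Fin N, ∏ t, (b.entry (emb y₀ c t) + β * kapz (k (emb y₀ c t))) := by
  unfold loopTr
  rw [trace_cycProd]
  rfl

omit [Fintype X] [DecidableEq X] in
/-- The same for the complex conjugate of the loop function. [folklore] -/
theorem conj_loopTr_add_smul_kapM (a : MField X L₀ N) (α : ℂ) (x₀ : X) (k : CIdx X L₀ N → ℝ × ℝ) :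
    conj (loopTr (fun t => a x₀ t + α • kapM k x₀ t)) =
      ∑ c : Fin L₀ → Fin N, ∏ t, (conj (a.entry (emb x₀ c t)) + conj α * conj (kapz (k (emb x₀ c t)))) := by
  rw [loopTr_add_smul_kapM, map_sum]
  refine Finset.sum_congr rfl fun c _ => ?_
  rw [map_prod]
  refine Finset.prod_congr rfl fun t _ => ?_
  rw [map_add, map_mul]

/-- A product over all coordinates of a function supported on the image of `emb x₀ c`. [folklore] -/
theorem prod_ite_emb (x₀ : X) (c : Fin L₀ → Fin N) (g : CIdx X L₀ N → ℂ) :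
    (∏ ι : CIdx X L₀ N, if ι = emb x₀ c ι.2.1 then g ι else 1) = ∏ t, g (emb x₀ c t) := by
  have h1 : (∏ ι : CIdx X L₀ N, if ι = emb x₀ c ι.2.1 then g ι else 1) =
      ∏ ι : CIdx X L₀ N, if ι ∈ Finset.univ.image (emb x₀ c) then g ι else 1 := by
    refine Finset.prod_congr rfl fun ι _ => ?_
    by_cases h : ι = emb x₀ c ι.2.1
    · rw [if_pos h, if_pos ((mem_image_emb_iff x₀ c ι).2 h)]
    · rw [if_neg h, if_neg (mt (mem_image_emb_iff x₀ c ι).1 h)]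
  rw [h1, Fintype.prod_extend_by_one, Finset.prod_image fun s _ t _ h => emb_injective x₀ c h]

/-- The per-coordinate factor of the integrand attached to the pair of index cycles `(c, c')`. [folklore] -/
def pairFactor (a b Δ : MField X L₀ N) (α β : ℂ) (x₀ y₀ : X) (c c' : Fin L₀ → Fin N)
    (ι : CIdx X L₀ N) (z : ℝ × ℝ) : ℂ :=
  phase (Δ.entry ι) z *
    (((if ι = emb x₀ c' ι.2.1 then conj (a.entry ι) else 1) +
        (if ι = emb x₀ c' ι.2.1 then conj α else 0) * conj (kapz z)) *
      ((if ι = emb y₀ c ι.2.1 then b.entry ι else 1) +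
        (if ι = emb y₀ c ι.2.1 then β else 0) * kapz z))

/-- **Product form of the integrand**: the phase times the conjugate loop function at `x₀` times
the loop function at `y₀` is a sum over pairs of index cycles of products over all coordinates. [folklore] -/
theorem integrand_eq_sum_prod (a b Δ : MField X L₀ N) (α β : ℂ) (x₀ y₀ : X)
    (k : CIdx X L₀ N → ℝ × ℝ) :
    tphase Δ k * conj (loopTr (fun t => a x₀ t + α • kapM k x₀ t)) *
        loopTr (fun t => b y₀ t + β • kapM k y₀ t) =
      ∑ c : Fin L₀ → Fin N, ∑ c' : Fin L₀ → Fin N,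
        ∏ ι, pairFactor a b Δ α β x₀ y₀ c c' ι (k ι) := by
  rw [conj_loopTr_add_smul_kapM, loopTr_add_smul_kapM, mul_assoc, Fintype.sum_mul_sum]
  simp only [Finset.mul_sum]
  rw [Finset.sum_comm]
  refine Finset.sum_congr rfl fun c _ => Finset.sum_congr rfl fun c' _ => ?_
  have hA : (∏ t, (conj (a.entry (emb x₀ c' t)) + conj α * conj (kapz (k (emb x₀ c' t))))) =
      ∏ ι : CIdx X L₀ N, ((if ι = emb x₀ c' ι.2.1 then conj (a.entry ι) else 1) +
        (if ι = emb x₀ c' ι.2.1 then conj α else 0) * conj (kapz (k ι))) := by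
    rw [← prod_ite_emb x₀ c' (fun ι => conj (a.entry ι) + conj α * conj (kapz (k ι)))]
    refine Finset.prod_congr rfl fun ι _ => ?_
    split_ifs <;> simp
  have hB : (∏ t, (b.entry (emb y₀ c t) + β * kapz (k (emb y₀ c t)))) =
      ∏ ι : CIdx X L₀ N, ((if ι = emb y₀ c ι.2.1 then b.entry ι else 1) +
        (if ι = emb y₀ c ι.2.1 then β else 0) * kapz (k ι)) := by
    rw [← prod_ite_emb y₀ c (fun ι => b.entry ι + β * kapz (k ι))]
    refine Finset.prod_congr rfl fun ι _ => ?_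
    split_ifs <;> simp
  rw [hA, hB]
  unfold tphase pairFactor
  rw [Finset.prod_mul_distrib, Finset.prod_mul_distrib]


/-! #### The Gaussian integral of the product form -/

/-- The transfer matrices `M_t = B'_t ⊗ A'_t + λ P` of the Gaussian computation. [folklore] -/
def gaussM (J : NNReal) (a b Δ : MField X L₀ N) (α β : ℂ) (x₀ y₀ : X) (t : Fin L₀) :
    Matrix (Fin N × Fin N) (Fin N × Fin N) ℂ :=
  (b y₀ t + (I * J * β) • Δ y₀ t) ⊗ₖ ((a x₀ t - (I * J * α) • Δ x₀ t).map conj) +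
    (if x₀ = y₀ then 2 * J * conj α * β else 0) • Pmat N

/-- The Gaussian prefactor `e^{-J ‖Δ‖²/2}`. [folklore] -/
def gaussE (J : NNReal) (Δ : MField X L₀ N) : ℂ :=
  cexp (-(J : ℂ) * (∑ ι : CIdx X L₀ N, (Complex.normSq (Δ.entry ι) : ℂ)) / 2)

variable (J)

/-- Integrability of the product integrand. [folklore] -/
theorem integrable_prod_pairFactor (a b Δ : MField X L₀ N) (α β : ℂ) (x₀ y₀ : X)
    (c c' : Fin L₀ → Fin N) :
    Integrable (fun k : CIdx X L₀ N → ℝ × ℝ => ∏ ι, pairFactor a b Δ α β x₀ y₀ c c' ι (k ι)) (γ J) := by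
  unfold γ
  refine Integrable.fintype_prod (f := fun ι z => pairFactor a b Δ α β x₀ y₀ c c' ι z) fun ι => ?_
  exact integrable_phase_mul_affine_mul_affine J _ _ _ _ _

omit [Fintype X] in
/-- The per-coordinate Gaussian integral of the pair factor. [folklore] -/
theorem integral_pairFactor (a b Δ : MField X L₀ N) (α β : ℂ) (x₀ y₀ : X)
    (c c' : Fin L₀ → Fin N) (ι : CIdx X L₀ N) :
    ∫ z, pairFactor a b Δ α β x₀ y₀ c c' ι z ∂(γ₂ J) =
      cexp (-(J : ℂ) * Complex.normSq (Δ.entry ι) / 2) *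
        (((if ι = emb x₀ c' ι.2.1 then conj (a.entry ι) else 1) +
            I * J * (if ι = emb x₀ c' ι.2.1 then conj α else 0) * conj (Δ.entry ι)) *
          ((if ι = emb y₀ c ι.2.1 then b.entry ι else 1) +
            I * J * (if ι = emb y₀ c ι.2.1 then β else 0) * Δ.entry ι) +
        2 * J * (if ι = emb x₀ c' ι.2.1 then conj α else 0) * (if ι = emb y₀ c ι.2.1 then β else 0)) :=
  integral_phase_mul_affine_mul_affine J _ _ _ _ _

/-- The value `A'` at a coordinate. [folklore] -/
def Aval (J : NNReal) (a Δ : MField X L₀ N) (α : ℂ) (ι : CIdx X L₀ N) : ℂ :=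
  conj (a.entry ι) + I * J * conj α * conj (Δ.entry ι)

/-- The value `B'` at a coordinate. [folklore] -/
def Bval (J : NNReal) (b Δ : MField X L₀ N) (β : ℂ) (ι : CIdx X L₀ N) : ℂ :=
  b.entry ι + I * J * β * Δ.entry ι

omit [Fintype X] in
/-- The per-coordinate value after integration, in product form. [folklore] -/
theorem integral_pairFactor_eq (a b Δ : MField X L₀ N) (α β : ℂ) (x₀ y₀ : X)
    (c c' : Fin L₀ → Fin N) (ι : CIdx X L₀ N) :
    ∫ z, pairFactor a b Δ α β x₀ y₀ c c' ι z ∂(γ₂ J) =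
      cexp (-(J : ℂ) * Complex.normSq (Δ.entry ι) / 2) *
        ((if ι = emb x₀ c' ι.2.1 then Aval J a Δ α ι else 1) *
          (if ι = emb y₀ c ι.2.1 then Bval J b Δ β ι else 1) +
        (if ι = emb x₀ c' ι.2.1 ∧ ι = emb y₀ c ι.2.1 then 2 * J * conj α * β else 0)) := by
  rw [integral_pairFactor]
  congr 1
  unfold Aval Bval
  by_cases hA : ι = emb x₀ c' ι.2.1 <;> by_cases hB : ι = emb y₀ c ι.2.1
  · simp only [if_pos hA, if_pos hB, if_pos (And.intro hA hB)]
  · simp only [if_pos hA, if_neg hB, if_neg (fun h : _ ∧ _ => hB h.2)]; ring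
  · simp only [if_neg hA, if_pos hB, if_neg (fun h : _ ∧ _ => hA h.1)]; ring
  · simp only [if_neg hA, if_neg hB, if_neg (fun h : _ ∧ _ => hA h.1)]; ring

omit [Fintype X] [DecidableEq X] in
/-- When the two embedded cycles meet: same site and same entries at the layer. [folklore] -/
theorem emb_eq_emb_iff (x₀ y₀ : X) (c c' : Fin L₀ → Fin N) (t : Fin L₀) :
    emb x₀ c' t = emb y₀ c t ↔ x₀ = y₀ ∧ (c t = c' t ∧ c (t + 1) = c' (t + 1)) := by
  simp only [emb, Prod.mk.injEq, true_and]
  constructor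
  · rintro ⟨h1, h2, h3⟩; exact ⟨h1, h2.symm, h3.symm⟩
  · rintro ⟨h1, h2, h3⟩; exact ⟨h1, h2.symm, h3.symm⟩

omit [Fintype X] in
/-- The relevant entries of the transfer matrices. [folklore] -/
theorem gaussM_apply_emb (a b Δ : MField X L₀ N) (α β : ℂ) (x₀ y₀ : X)
    (c c' : Fin L₀ → Fin N) (t : Fin L₀) :
    gaussM J a b Δ α β x₀ y₀ t (c t, c' t) (c (t + 1), c' (t + 1)) =
      Bval J b Δ β (emb y₀ c t) * Aval J a Δ α (emb x₀ c' t) +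
        (if x₀ = y₀ then 2 * J * conj α * β else 0) *
          (if c t = c' t ∧ c (t + 1) = c' (t + 1) then 1 else 0) := by
  simp only [gaussM, Matrix.add_apply, Matrix.kroneckerMap_apply, Matrix.map_apply, Matrix.smul_apply,
    Matrix.sub_apply, smul_eq_mul, Pmat_apply, Bval, Aval, MField.entry, emb, map_sub, map_mul,
    Complex.conj_I, Complex.conj_ofReal]
  ring

/-- **The combinatorial heart**: the product over all coordinates of the integrated pair factors is a
product over layers of entries of the transfer matrices `gaussM`. [folklore] -/
theorem prod_integral_factor_eq (a b Δ : MField X L₀ N) (α β : ℂ) (x₀ y₀ : X)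
    (c c' : Fin L₀ → Fin N) :
    (∏ ι : CIdx X L₀ N, ((if ι = emb x₀ c' ι.2.1 then Aval J a Δ α ι else 1) *
          (if ι = emb y₀ c ι.2.1 then Bval J b Δ β ι else 1) +
        (if ι = emb x₀ c' ι.2.1 ∧ ι = emb y₀ c ι.2.1 then 2 * J * conj α * β else 0))) =
      ∏ t, gaussM J a b Δ α β x₀ y₀ t (c t, c' t) (c (t + 1), c' (t + 1)) := by
  set G : CIdx X L₀ N → ℂ := fun ι => (if ι = emb x₀ c' ι.2.1 then Aval J a Δ α ι else 1) *
          (if ι = emb y₀ c ι.2.1 then Bval J b Δ β ι else 1) +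
        (if ι = emb x₀ c' ι.2.1 ∧ ι = emb y₀ c ι.2.1 then 2 * J * conj α * β else 0) with hG
  set S : Fin L₀ → Finset (CIdx X L₀ N) := fun t => insert (emb x₀ c' t) {emb y₀ c t} with hS
  have hdisj : (↑(Finset.univ : Finset (Fin L₀)) : Set (Fin L₀)).PairwiseDisjoint S := by
    intro s _ t _ hst
    rw [Function.onFun, Finset.disjoint_left]
    intro ι hs ht
    simp only [hS, Finset.mem_insert, Finset.mem_singleton] at hs ht
    have h1 : ι.2.1 = s := by rcases hs with rfl | rfl <;> rfl
    have h2 : ι.2.1 = t := by rcases ht with rfl | rfl <;> rfl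
    exact hst (h1.symm.trans h2)
  have hsupp : ∀ ι, ι ∉ Finset.univ.biUnion S → G ι = 1 := by
    intro ι hι
    have hA : ι ≠ emb x₀ c' ι.2.1 := fun h =>
      hι (Finset.mem_biUnion.2 ⟨ι.2.1, Finset.mem_univ _, by rw [hS]; simp [← h]⟩)
    have hB : ι ≠ emb y₀ c ι.2.1 := fun h =>
      hι (Finset.mem_biUnion.2 ⟨ι.2.1, Finset.mem_univ _, by rw [hS]; simp [← h]⟩)
    simp [hG, hA, hB]
  have hstep1 : (∏ ι, G ι) = ∏ ι ∈ Finset.univ.biUnion S, G ι :=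
    (Finset.prod_subset (Finset.subset_univ _) fun ι _ hι => hsupp ι hι).symm
  rw [hstep1, Finset.prod_biUnion hdisj]
  refine Finset.prod_congr rfl fun t _ => ?_
  rw [gaussM_apply_emb]
  by_cases h : emb x₀ c' t = emb y₀ c t
  · -- the two coordinates coincide: a contraction
    have hx := (emb_eq_emb_iff x₀ y₀ c c' t).1 h
    have c1 : emb y₀ c t = emb x₀ c' (emb y₀ c t : CIdx X L₀ N).2.1 := h.symm
    have c2 : emb y₀ c t = emb y₀ c (emb y₀ c t : CIdx X L₀ N).2.1 := rfl
    rw [hS]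
    dsimp only
    rw [h, Finset.insert_eq_of_mem (Finset.mem_singleton_self _), Finset.prod_singleton]
    simp only [hG, if_pos c1, if_pos c2, if_pos (And.intro c1 c2), if_pos hx.1, if_pos hx.2]
    ring
  · have c1A : emb x₀ c' t = emb x₀ c' (emb x₀ c' t : CIdx X L₀ N).2.1 := rfl
    have c2A : ¬ emb x₀ c' t = emb y₀ c (emb x₀ c' t : CIdx X L₀ N).2.1 := h
    have c1B : ¬ emb y₀ c t = emb x₀ c' (emb y₀ c t : CIdx X L₀ N).2.1 := fun e => h e.symm
    have c2B : emb y₀ c t = emb y₀ c (emb y₀ c t : CIdx X L₀ N).2.1 := rfl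
    have hx : ¬(x₀ = y₀ ∧ (c t = c' t ∧ c (t + 1) = c' (t + 1))) := fun h' =>
      h ((emb_eq_emb_iff x₀ y₀ c c' t).2 h')
    rw [hS]
    dsimp only
    rw [Finset.prod_pair h]
    simp only [hG, if_pos c1A, if_neg c2A, if_neg c1B, if_pos c2B,
      if_neg (fun hh : _ ∧ _ => c2A hh.2), if_neg (fun hh : _ ∧ _ => c1B hh.1)]
    by_cases hxy : x₀ = y₀
    · have hcc : ¬(c t = c' t ∧ c (t + 1) = c' (t + 1)) := fun h'' => hx ⟨hxy, h''⟩
      rw [if_neg hcc]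
      ring
    · rw [if_neg hxy]
      ring

/-- **The multilinear Gaussian computation** (general two-site form). [folklore] -/
theorem integral_tphase_mul_conj_loopTr_mul_loopTr (a b Δ : MField X L₀ N) (α β : ℂ) (x₀ y₀ : X) :
    ∫ k, tphase Δ k * conj (loopTr (fun t => a x₀ t + α • kapM k x₀ t)) *
        loopTr (fun t => b y₀ t + β • kapM k y₀ t) ∂(γ J) =
      gaussE J Δ * (cycProd (gaussM J a b Δ α β x₀ y₀)).trace := by
  have hfun : (fun k : CIdx X L₀ N → ℝ × ℝ => tphase Δ k *
      conj (loopTr (fun t => a x₀ t + α • kapM k x₀ t)) * loopTr (fun t => b y₀ t + β • kapM k y₀ t)) =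
      fun k => ∑ c : Fin L₀ → Fin N, ∑ c' : Fin L₀ → Fin N,
        ∏ ι, pairFactor a b Δ α β x₀ y₀ c c' ι (k ι) := funext (integrand_eq_sum_prod a b Δ α β x₀ y₀)
  rw [hfun, integral_finsetSum _ fun c _ => integrable_finsetSum _ fun c' _ =>
    integrable_prod_pairFactor J a b Δ α β x₀ y₀ c c']
  simp_rw [integral_finsetSum _ fun c' _ => integrable_prod_pairFactor J a b Δ α β x₀ y₀ _ c']
  have hprod : ∀ c c' : Fin L₀ → Fin N,
      ∫ k, ∏ ι, pairFactor a b Δ α β x₀ y₀ c c' ι (k ι) ∂(γ J) =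
        gaussE J Δ * ∏ t, gaussM J a b Δ α β x₀ y₀ t (c t, c' t) (c (t + 1), c' (t + 1)) := by
    intro c c'
    unfold γ
    rw [integral_fintype_prod_eq_prod (f := fun ι z => pairFactor a b Δ α β x₀ y₀ c c' ι z)]
    simp_rw [integral_pairFactor_eq]
    rw [Finset.prod_mul_distrib, prod_integral_factor_eq]
    congr 1
    unfold gaussE
    rw [← Complex.exp_sum]
    congr 1
    rw [Finset.mul_sum, Finset.sum_div]
  simp_rw [hprod]
  rw [trace_cycProd]
  simp_rw [← Finset.mul_sum]
  congr 1
  rw [← (Equiv.arrowProdEquivProdArrow (Fin L₀) (fun _ => Fin N) (fun _ => Fin N)).symm.sum_comp,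
    Fintype.sum_prod_type]
  rfl

end Multi

/-! ### Kronecker factorisation, the kernel `Ξ` and its bound -/

section Xi

variable {N : ℕ}

variable {L₀ : ℕ}

/-- `f(m̄) = conj f(m)` for the loop function. [folklore] -/
theorem loopTr_map_conj (q : Fin L₀ → Matrix (Fin N) (Fin N) ℂ) :
    loopTr (fun t => (q t).map conj) = conj (loopTr q) := by
  unfold loopTr
  rw [cycProd_map_conj, trace_map_conj]

/-- `tr ∏ₜ (p t ⊗ q̄ t) = f(p) conj f(q)`. [folklore] -/
theorem trace_cycProd_kronecker_map_conj (p q : Fin L₀ → Matrix (Fin N) (Fin N) ℂ) :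
    (cycProd (fun t => p t ⊗ₖ (q t).map conj)).trace = loopTr p * conj (loopTr q) := by
  rw [cycProd_kronecker, Matrix.trace_kronecker, ← loopTr_map_conj]
  rfl

/-- **The kernel `Ξ`**: `Ξ_J(p, q) = tr ∏ₜ (p t ⊗ q̄ t + (2/J) P) − f(p) conj f(q)`, the generating
function of the "broken loop" terms of Borgs–Seiler's expansion (III.49)–(III.56). [folklore] -/
def Xi (J : NNReal) (p q : Fin L₀ → Matrix (Fin N) (Fin N) ℂ) : ℂ :=
  (cycProd (fun t => p t ⊗ₖ (q t).map conj + ((2 : ℂ) / J) • Pmat N)).trace -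
    loopTr p * conj (loopTr q)

/-- **The bound on `Ξ`**: for unitary `p t, q t` and `J > 0`, `|Ξ_J(p, q)| ≤ (1 + 2N/J)^{L₀} − 1`
(Borgs–Seiler: each of the `(L₀ choose k)` broken-loop terms of order `(2/J)^k` is a product of `k`
Wilson loops, each bounded by `χ(1) = N`). [folklore] -/
theorem norm_Xi_le {J : NNReal} (hJ : J ≠ 0) {p q : Fin L₀ → Matrix (Fin N) (Fin N) ℂ}
    (hp : ∀ t, p t ∈ Matrix.unitaryGroup (Fin N) ℂ) (hq : ∀ t, q t ∈ Matrix.unitaryGroup (Fin N) ℂ) :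
    ‖Xi J p q‖ ≤ (1 + 2 * N / J) ^ L₀ - 1 := by
  have hA : ∀ t, p t ⊗ₖ (q t).map conj ∈ Matrix.unitaryGroup (Fin N × Fin N) ℂ := fun t =>
    Matrix.kronecker_mem_unitary (hp t) (map_conj_mem_unitaryGroup (hq t))
  have hlam : (0 : ℝ) ≤ 2 / J := by positivity
  have h := norm_trace_mul_cycProd_sub_le (fun t => p t ⊗ₖ (q t).map conj) hA (omegaVec N) hlam
    (Submonoid.one_mem _)
  rw [one_mul, vnorm_omegaVec_sq] at h
  have hcast : ((2 / J : ℝ) : ℂ) = (2 : ℂ) / J := by push_cast; rfl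
  unfold Xi
  rw [← trace_cycProd_kronecker_map_conj, ← Matrix.trace_sub]
  convert h using 2
  · rw [hcast]; rfl
  · ring

end Xi

/-! ### The Gram kernel identity (GI) -/

section GI

variable {X : Type*} [Fintype X] [DecidableEq X] {L₀ N : ℕ} [NeZero L₀]

/-- The coefficient `α₀ = -i/J` of the Gaussian shift `b ↦ b - iκ/J`. [folklore] -/
def alpha0 (J : NNReal) : ℂ := -I * (J : ℂ)⁻¹

/-- `iJα₀ = 1`. [folklore] -/
theorem I_mul_J_mul_alpha0 {J : NNReal} (hJ : J ≠ 0) : I * J * alpha0 J = 1 := by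
  unfold alpha0
  have hJ' : (J : ℂ) ≠ 0 := by exact_mod_cast hJ
  field_simp
  rw [I_sq]
  ring

/-- `conj α₀ = i/J`. [folklore] -/
theorem conj_alpha0 (J : NNReal) : conj (alpha0 J) = I * (J : ℂ)⁻¹ := by
  unfold alpha0
  simp [map_mul, map_neg, Complex.conj_I, map_inv₀, Complex.conj_ofReal]

/-- `2J |α₀|² = 2/J` — the expansion parameter `2χ(1)/J_E` per contraction, before the factor
`χ(1)`. [cite: BorgsSeiler1983, §III.2 (III.48), (III.58) (pp. 351–352)] -/
theorem two_mul_J_mul_conj_alpha0_mul_alpha0 {J : NNReal} (hJ : J ≠ 0) :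
    2 * (J : ℂ) * conj (alpha0 J) * alpha0 J = 2 / J := by
  rw [conj_alpha0]
  unfold alpha0
  have hJ' : (J : ℂ) ≠ 0 := by exact_mod_cast hJ
  field_simp
  rw [I_sq]
  ring

/-- `R_x(k, b) = f(b_x − iκ_x/J) − f(b_x)`. [folklore] -/
def Rsite (J : NNReal) (k : CIdx X L₀ N → ℝ × ℝ) (b : MField X L₀ N) (x : X) : ℂ :=
  loopTr (fun t => b x t + alpha0 J • kapM k x t) - loopTr (b x)

/-- The smeared difference `R_h(k, b) = Σ_x h_x R_x(k, b)`. [folklore] -/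
def Rsum (J : NNReal) (h : X → ℂ) (k : CIdx X L₀ N → ℝ × ℝ) (b : MField X L₀ N) : ℂ :=
  ∑ x, h x * Rsite J k b x

/-- The real pairing `⟨k, b⟩ = Σ_ι (k_ι¹ Re b_ι + k_ι² Im b_ι)`. [folklore] -/
def rin (k : CIdx X L₀ N → ℝ × ℝ) (b : MField X L₀ N) : ℝ :=
  ∑ ι, ((k ι).1 * (b.entry ι).re + (k ι).2 * (b.entry ι).im)

/-- **The Gram feature** `r_k(b) = e^{-i⟨k,b⟩} R_h(k, b)`: the function whose Gram kernel
`∫ conj r_k(a) r_k(b) dγ(k)` is the Borgs–Seiler kernel (theorem `integral_conj_rker_mul_rker`). [folklore] -/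
def rker (J : NNReal) (h : X → ℂ) (k : CIdx X L₀ N → ℝ × ℝ) (b : MField X L₀ N) : ℂ :=
  cexp (-(I * rin k b)) * Rsum J h k b

omit [Fintype X] [DecidableEq X] [NeZero L₀] in
/-- Entries of a difference. [folklore] -/
theorem sub_entry (a b : MField X L₀ N) (ι : CIdx X L₀ N) : (a - b).entry ι = a.entry ι - b.entry ι := rfl

omit [DecidableEq X] [NeZero L₀] in
/-- The total phase of a difference. [folklore] -/
theorem tphase_sub (a b : MField X L₀ N) (k : CIdx X L₀ N → ℝ × ℝ) :
    tphase (a - b) k = conj (cexp (-(I * rin k a))) * cexp (-(I * rin k b)) := by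
  rw [← Complex.exp_conj, ← Complex.exp_add]
  unfold tphase phase
  simp_rw [← Complex.exp_add]
  rw [← Complex.exp_sum]
  congr 1
  simp only [map_neg, map_mul, Complex.conj_I, Complex.conj_ofReal, rin, sub_entry, Complex.sub_re,
    Complex.sub_im]
  push_cast
  rw [Finset.mul_sum, Finset.mul_sum, ← Finset.sum_neg_distrib, ← Finset.sum_neg_distrib,
    ← Finset.sum_add_distrib]
  refine Finset.sum_congr rfl fun ι _ => ?_
  ring

omit [DecidableEq X] [NeZero L₀] in
/-- The Gram integrand is the total phase times `conj R_h(k,a) R_h(k,b)`. [folklore] -/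
theorem conj_rker_mul_rker (J : NNReal) (h : X → ℂ) (k : CIdx X L₀ N → ℝ × ℝ) (a b : MField X L₀ N) :
    conj (rker J h k a) * rker J h k b = tphase (a - b) k * (conj (Rsum J h k a) * Rsum J h k b) := by
  unfold rker
  rw [tphase_sub, map_mul]
  ring

/-- The four basic integrands. [folklore] -/
def basicF (a b : MField X L₀ N) (α β : ℂ) (x y : X) (k : CIdx X L₀ N → ℝ × ℝ) : ℂ :=
  tphase (a - b) k * conj (loopTr (fun t => a x t + α • kapM k x t)) *
    loopTr (fun t => b y t + β • kapM k y t)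

omit [Fintype X] [DecidableEq X] [NeZero L₀] in
/-- A zero shift does nothing. [folklore] -/
theorem loopTr_add_zero_smul (b : MField X L₀ N) (y : X) (k : CIdx X L₀ N → ℝ × ℝ) :
    loopTr (fun t => b y t + (0 : ℂ) • kapM k y t) = loopTr (b y) := by
  simp only [zero_smul, add_zero]

omit [DecidableEq X] [NeZero L₀] in
/-- Expansion of the Gram integrand into the four basic integrands. [folklore] -/
theorem conj_rker_mul_rker_eq_sum (J : NNReal) (h : X → ℂ) (k : CIdx X L₀ N → ℝ × ℝ)
    (a b : MField X L₀ N) :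
    conj (rker J h k a) * rker J h k b = ∑ x, ∑ y, conj (h x) * h y *
      (basicF a b (alpha0 J) (alpha0 J) x y k - basicF a b (alpha0 J) 0 x y k -
        basicF a b 0 (alpha0 J) x y k + basicF a b 0 0 x y k) := by
  rw [conj_rker_mul_rker]
  unfold Rsum
  rw [map_sum, Fintype.sum_mul_sum, Finset.mul_sum]
  refine Finset.sum_congr rfl fun x _ => ?_
  rw [Finset.mul_sum]
  refine Finset.sum_congr rfl fun y _ => ?_
  unfold basicF Rsite
  simp only [loopTr_add_zero_smul, map_mul, map_sub]
  ring

variable (J : NNReal)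

/-- Integrability of the basic integrands. [folklore] -/
theorem integrable_basicF (a b : MField X L₀ N) (α β : ℂ) (x y : X) :
    Integrable (basicF a b α β x y) (γ J) := by
  have hfun : basicF a b α β x y = fun k => ∑ c : Fin L₀ → Fin N, ∑ c' : Fin L₀ → Fin N,
      ∏ ι, pairFactor a b (a - b) α β x y c c' ι (k ι) :=
    funext (integrand_eq_sum_prod a b (a - b) α β x y)
  rw [hfun]
  exact integrable_finsetSum _ fun c _ => integrable_finsetSum _ fun c' _ =>
    integrable_prod_pairFactor J a b (a - b) α β x y c c'

/-- The integral of a basic integrand. [folklore] -/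
theorem integral_basicF (a b : MField X L₀ N) (α β : ℂ) (x y : X) :
    ∫ k, basicF a b α β x y k ∂(γ J) = gaussE J (a - b) * (cycProd (gaussM J a b (a - b) α β x y)).trace :=
  integral_tphase_mul_conj_loopTr_mul_loopTr J a b (a - b) α β x y

variable {J}

omit [Fintype X] [NeZero L₀] in
/-- Evaluation of the four transfer matrices at `Δ = a - b`. [folklore] -/
theorem gaussM_alpha0_alpha0 (hJ : J ≠ 0) (a b : MField X L₀ N) (x y : X) :
    gaussM J a b (a - b) (alpha0 J) (alpha0 J) x y = fun t =>
      a y t ⊗ₖ (b x t).map conj + (if x = y then (2 : ℂ) / J else 0) • Pmat N := by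
  funext t
  unfold gaussM
  rw [I_mul_J_mul_alpha0 hJ, two_mul_J_mul_conj_alpha0_mul_alpha0 hJ, one_smul, one_smul]
  congr 2
  · rw [Pi.sub_apply, Pi.sub_apply, add_sub_cancel]
  · rw [Pi.sub_apply, Pi.sub_apply, sub_sub_cancel]

omit [Fintype X] [NeZero L₀] in
/-- The transfer matrices for `(α, β) = (α₀, 0)`: no contraction, `bₜ ⊗ conj(bₜ)`. [folklore] -/
theorem gaussM_alpha0_zero (hJ : J ≠ 0) (a b : MField X L₀ N) (x y : X) :
    gaussM J a b (a - b) (alpha0 J) 0 x y = fun t => b y t ⊗ₖ (b x t).map conj := by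
  funext t
  unfold gaussM
  rw [I_mul_J_mul_alpha0 hJ, one_smul]
  simp only [mul_zero, zero_smul, add_zero, ite_self, Pi.sub_apply, sub_sub_cancel]

omit [Fintype X] [NeZero L₀] in
/-- The transfer matrices for `(α, β) = (0, α₀)`: no contraction, `aₜ ⊗ conj(aₜ)`. [folklore] -/
theorem gaussM_zero_alpha0 (hJ : J ≠ 0) (a b : MField X L₀ N) (x y : X) :
    gaussM J a b (a - b) 0 (alpha0 J) x y = fun t => a y t ⊗ₖ (a x t).map conj := by
  funext t
  unfold gaussM
  rw [I_mul_J_mul_alpha0 hJ, one_smul]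
  simp only [map_zero, mul_zero, zero_mul, zero_smul, add_zero, ite_self, Pi.sub_apply,
    add_sub_cancel, sub_zero]

omit [Fintype X] [NeZero L₀] in
/-- The transfer matrices for `(α, β) = (0, 0)`: `bₜ ⊗ conj(aₜ)`. [folklore] -/
theorem gaussM_zero_zero (a b : MField X L₀ N) (x y : X) :
    gaussM J a b (a - b) 0 0 x y = fun t => b y t ⊗ₖ (a x t).map conj := by
  funext t
  unfold gaussM
  simp only [map_zero, mul_zero, zero_smul, add_zero, ite_self, sub_zero]

omit [Fintype X] [NeZero L₀] in
/-- The trace in the contracting case. [folklore] -/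
theorem trace_cycProd_gaussM_alpha0_alpha0 (hJ : J ≠ 0) (a b : MField X L₀ N) (x y : X) :
    (cycProd (gaussM J a b (a - b) (alpha0 J) (alpha0 J) x y)).trace =
      loopTr (a y) * conj (loopTr (b x)) + (if x = y then Xi J (a x) (b x) else 0) := by
  rw [gaussM_alpha0_alpha0 hJ]
  by_cases hxy : x = y
  · subst hxy
    simp only [if_true, Xi]
    ring
  · simp only [hxy, if_false, zero_smul, add_zero, trace_cycProd_kronecker_map_conj]

/-- **The Gram kernel identity (GI).** For `J > 0`, complex weights `h` and matrix fields `a, b`,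
`∫ conj r_k(a) · r_k(b) dγ_J(k) = e^{-J‖a-b‖²/2} ( Σ_x |h_x|² Ξ_J(a_x, b_x) − |Σ_x h_x (f(a_x) − f(b_x))|² )`.
This is Borgs–Seiler's `[L(h)*,[L(h),T]] ≤ Σ_x |h_x|² (T L_x* T⁻¹ L_x T − L_x T L_x*)` ((III.41),
(III.51)) together with the expansion (III.48)–(III.53), in the form of an explicit Gram (hence positive
semidefinite) kernel for the difference. [folklore] -/
theorem integral_conj_rker_mul_rker (hJ : J ≠ 0) (h : X → ℂ) (a b : MField X L₀ N) :
    ∫ k, conj (rker J h k a) * rker J h k b ∂(γ J) =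
      gaussE J (a - b) * ((∑ x, (Complex.normSq (h x) : ℂ) * Xi J (a x) (b x)) -
        Complex.normSq (∑ x, h x * (loopTr (a x) - loopTr (b x)))) := by
  simp_rw [conj_rker_mul_rker_eq_sum]
  have hint : ∀ x y, Integrable (fun k => conj (h x) * h y *
      (basicF a b (alpha0 J) (alpha0 J) x y k - basicF a b (alpha0 J) 0 x y k -
        basicF a b 0 (alpha0 J) x y k + basicF a b 0 0 x y k)) (γ J) := fun x y =>
    ((((integrable_basicF J a b _ _ x y).sub (integrable_basicF J a b _ _ x y)).sub
      (integrable_basicF J a b _ _ x y)).add (integrable_basicF J a b _ _ x y)).const_mul _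
  rw [integral_finsetSum _ fun x _ => integrable_finsetSum _ fun y _ => hint x y]
  simp_rw [integral_finsetSum _ fun y _ => hint _ y]
  have hxy : ∀ x y, ∫ k, conj (h x) * h y *
      (basicF a b (alpha0 J) (alpha0 J) x y k - basicF a b (alpha0 J) 0 x y k -
        basicF a b 0 (alpha0 J) x y k + basicF a b 0 0 x y k) ∂(γ J) =
      conj (h x) * h y *
      (gaussE J (a - b) * (loopTr (a y) * conj (loopTr (b x)) + (if x = y then Xi J (a x) (b x) else 0)) -
        gaussE J (a - b) * (loopTr (b y) * conj (loopTr (b x))) -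
        gaussE J (a - b) * (loopTr (a y) * conj (loopTr (a x))) +
        gaussE J (a - b) * (loopTr (b y) * conj (loopTr (a x)))) := by
    intro x y
    have i1 := integrable_basicF J a b (alpha0 J) (alpha0 J) x y
    have i2 := integrable_basicF J a b (alpha0 J) 0 x y
    have i3 := integrable_basicF J a b 0 (alpha0 J) x y
    have i4 := integrable_basicF J a b 0 0 x y
    have e1 : ∫ k, (basicF a b (alpha0 J) (alpha0 J) x y k - basicF a b (alpha0 J) 0 x y k -
        basicF a b 0 (alpha0 J) x y k + basicF a b 0 0 x y k) ∂(γ J) =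
        (∫ k, (basicF a b (alpha0 J) (alpha0 J) x y k - basicF a b (alpha0 J) 0 x y k -
          basicF a b 0 (alpha0 J) x y k) ∂(γ J)) + ∫ k, basicF a b 0 0 x y k ∂(γ J) :=
      integral_add (by exact (i1.sub i2).sub i3) i4
    have e2 : ∫ k, (basicF a b (alpha0 J) (alpha0 J) x y k - basicF a b (alpha0 J) 0 x y k -
        basicF a b 0 (alpha0 J) x y k) ∂(γ J) =
        (∫ k, (basicF a b (alpha0 J) (alpha0 J) x y k - basicF a b (alpha0 J) 0 x y k) ∂(γ J)) -
          ∫ k, basicF a b 0 (alpha0 J) x y k ∂(γ J) :=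
      integral_sub (by exact i1.sub i2) i3
    have e3 : ∫ k, (basicF a b (alpha0 J) (alpha0 J) x y k - basicF a b (alpha0 J) 0 x y k) ∂(γ J) =
        (∫ k, basicF a b (alpha0 J) (alpha0 J) x y k ∂(γ J)) - ∫ k, basicF a b (alpha0 J) 0 x y k ∂(γ J) :=
      integral_sub i1 i2
    rw [integral_const_mul, e1, e2, e3, integral_basicF, integral_basicF, integral_basicF, integral_basicF,
      trace_cycProd_gaussM_alpha0_alpha0 hJ, gaussM_alpha0_zero hJ, gaussM_zero_alpha0 hJ,
      gaussM_zero_zero, trace_cycProd_kronecker_map_conj, trace_cycProd_kronecker_map_conj,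
      trace_cycProd_kronecker_map_conj]
  simp_rw [hxy]
  -- pure algebra
  have key : ∀ x y : X, conj (h x) * h y *
      (gaussE J (a - b) * (loopTr (a y) * conj (loopTr (b x)) + (if x = y then Xi J (a x) (b x) else 0)) -
        gaussE J (a - b) * (loopTr (b y) * conj (loopTr (b x))) -
        gaussE J (a - b) * (loopTr (a y) * conj (loopTr (a x))) +
        gaussE J (a - b) * (loopTr (b y) * conj (loopTr (a x)))) =
      gaussE J (a - b) * ((if x = y then conj (h x) * h x * Xi J (a x) (b x) else 0) -
        (h y * (loopTr (a y) - loopTr (b y))) * conj (h x * (loopTr (a x) - loopTr (b x)))) := by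
    intro x y
    by_cases hxy : x = y
    · subst hxy; simp only [if_true, map_mul, map_sub]; ring
    · simp only [hxy, if_false, map_mul, map_sub]; ring
  simp_rw [key, ← Finset.mul_sum, Finset.sum_sub_distrib]
  congr 1
  rw [Finset.sum_comm]
  simp only [Finset.sum_ite_eq', Finset.mem_univ, if_true]
  congr 1
  · refine Finset.sum_congr rfl fun x _ => ?_
    rw [Complex.normSq_eq_conj_mul_self]
  · rw [Finset.sum_comm, ← Fintype.sum_mul_sum, ← map_sum, Complex.mul_conj]

end GI

/-! ### Bounds, domination and continuity of the Gram feature -/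

section Bounds

variable {X : Type*} [Fintype X] [DecidableEq X] {L₀ N : ℕ} [NeZero L₀]

omit [NeZero L₀] in
/-- Bound for the loop function. [folklore] -/
theorem norm_loopTr_le {M : Fin L₀ → Matrix (Fin N) (Fin N) ℂ} {m : ℝ} (hm : 0 ≤ m)
    (hM : ∀ t e e', ‖M t e e'‖ ≤ m) : ‖loopTr M‖ ≤ N * (N * m) ^ L₀ := by
  unfold loopTr Matrix.trace
  calc ‖∑ e, Matrix.diag (cycProd M) e‖ ≤ ∑ e, ‖Matrix.diag (cycProd M) e‖ := norm_sum_le _ _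
    _ ≤ ∑ _e : Fin N, (N * m) ^ L₀ := Finset.sum_le_sum fun e _ => norm_cycProd_apply_le hm hM e e
    _ = N * (N * m) ^ L₀ := by
        rw [Finset.sum_const, Finset.card_univ, Fintype.card_fin, nsmul_eq_mul]

/-- The size `K(k) = Σ_ι |κ_ι|` of a Gaussian configuration. [folklore] -/
def Ksum (k : CIdx X L₀ N → ℝ × ℝ) : ℝ := ∑ ι, ‖kapz (k ι)‖

omit [DecidableEq X] [NeZero L₀] in
/-- `K ≥ 0`. [folklore] -/
theorem Ksum_nonneg (k : CIdx X L₀ N → ℝ × ℝ) : 0 ≤ Ksum k :=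
  Finset.sum_nonneg fun _ _ => norm_nonneg _

omit [DecidableEq X] [NeZero L₀] in
/-- `|κ_ι| ≤ K`. [folklore] -/
theorem norm_kapz_le_Ksum (k : CIdx X L₀ N → ℝ × ℝ) (ι : CIdx X L₀ N) : ‖kapz (k ι)‖ ≤ Ksum k :=
  Finset.single_le_sum (f := fun ι => ‖kapz (k ι)‖) (fun _ _ => norm_nonneg _) (Finset.mem_univ ι)

omit [NeZero L₀] in
/-- `|α₀| = 1/J`. [folklore] -/
theorem norm_alpha0 (J : NNReal) : ‖alpha0 J‖ = (J : ℝ)⁻¹ := by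
  unfold alpha0
  rw [norm_mul, norm_neg, Complex.norm_I, one_mul, norm_inv, Complex.norm_real, Real.norm_of_nonneg
    J.coe_nonneg]

omit [DecidableEq X] [NeZero L₀] in
/-- Bound for `R_x(k, b)` when the entries of `b` are bounded by `1`. [folklore] -/
theorem norm_Rsite_le (J : NNReal) {b : MField X L₀ N} (hb : ∀ x t e e', ‖b x t e e'‖ ≤ 1)
    (k : CIdx X L₀ N → ℝ × ℝ) (x : X) :
    ‖Rsite J k b x‖ ≤ 2 * (N * (N * (1 + Ksum k / J)) ^ L₀) := by
  have hm : (0 : ℝ) ≤ 1 + Ksum k / J := by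
    have := Ksum_nonneg k; positivity
  have h1 : ‖loopTr (fun t => b x t + alpha0 J • kapM k x t)‖ ≤ N * (N * (1 + Ksum k / J)) ^ L₀ := by
    refine norm_loopTr_le hm fun t e e' => ?_
    rw [Matrix.add_apply, Matrix.smul_apply, smul_eq_mul]
    refine (norm_add_le _ _).trans (add_le_add (hb x t e e') ?_)
    rw [norm_mul, norm_alpha0, div_eq_inv_mul]
    exact mul_le_mul_of_nonneg_left (norm_kapz_le_Ksum k (x, t, e, e')) (inv_nonneg.2 J.coe_nonneg)
  have h2 : ‖loopTr (b x)‖ ≤ N * (N * (1 + Ksum k / J)) ^ L₀ := by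
    refine (norm_loopTr_le zero_le_one fun t e e' => hb x t e e').trans ?_
    refine mul_le_mul_of_nonneg_left (pow_le_pow_left₀ (by positivity) ?_ L₀) (Nat.cast_nonneg N)
    rw [mul_one]
    refine le_mul_of_one_le_right (Nat.cast_nonneg N) ?_
    have := Ksum_nonneg k
    have : 0 ≤ Ksum k / J := by positivity
    linarith
  unfold Rsite
  exact (norm_sub_le _ _).trans (by linarith)

omit [DecidableEq X] [NeZero L₀] in
/-- **Bound for the Gram feature**: `|r_k(b)| ≤ 2N (Σ|h_x|) (N(1 + K(k)/J))^{L₀}` when the entries of `b`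
are bounded by `1` (e.g. unitary blocks). [folklore] -/
theorem norm_rker_le (J : NNReal) (h : X → ℂ) {b : MField X L₀ N} (hb : ∀ x t e e', ‖b x t e e'‖ ≤ 1)
    (k : CIdx X L₀ N → ℝ × ℝ) :
    ‖rker J h k b‖ ≤ (2 * N * ∑ x, ‖h x‖) * (N * (1 + Ksum k / J)) ^ L₀ := by
  unfold rker Rsum
  rw [norm_mul, show (-(I * (rin k b : ℂ))) = ((-rin k b : ℝ) : ℂ) * I by push_cast; ring,
    Complex.norm_exp_ofReal_mul_I, one_mul]
  calc ‖∑ x, h x * Rsite J k b x‖ ≤ ∑ x, ‖h x * Rsite J k b x‖ := norm_sum_le _ _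
    _ ≤ ∑ x, ‖h x‖ * (2 * (N * (N * (1 + Ksum k / J)) ^ L₀)) := Finset.sum_le_sum fun x _ => by
        rw [norm_mul]
        exact mul_le_mul_of_nonneg_left (norm_Rsite_le J hb k x) (norm_nonneg _)
    _ = (2 * N * ∑ x, ‖h x‖) * (N * (1 + Ksum k / J)) ^ L₀ := by rw [← Finset.sum_mul]; ring

/-- The global dominating function `∏_ι dom₂(k_ι)` with `m = 2L₀`. [folklore] -/
def gDom (J : NNReal) (L₀ : ℕ) (k : CIdx X L₀ N → ℝ × ℝ) : ℝ := ∏ ι, dom₂ J (2 * L₀) (k ι)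

omit [DecidableEq X] [NeZero L₀] in
/-- The dominating function is `γ`-integrable. [folklore] -/
theorem integrable_gDom (J : NNReal) : Integrable (gDom (X := X) (N := N) J L₀) (γ J) := by
  unfold gDom γ
  exact Integrable.fintype_prod (f := fun _ z => dom₂ J (2 * L₀) z) fun _ => integrable_dom₂ J _

omit [DecidableEq X] [NeZero L₀] in
/-- `1 + Σ c_ι ≤ ∏ (1 + c_ι)` for nonnegative `c`. [folklore] -/
theorem one_add_sum_le_prod_one_add {ι : Type*} (s : Finset ι) {c : ι → ℝ} (hc : ∀ i ∈ s, 0 ≤ c i) :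
    1 + ∑ i ∈ s, c i ≤ ∏ i ∈ s, (1 + c i) := by
  classical
  induction s using Finset.induction_on with
  | empty => simp
  | insert a s ha ih =>
      rw [Finset.sum_insert ha, Finset.prod_insert ha]
      have hca : 0 ≤ c a := hc a (Finset.mem_insert_self a s)
      have hs : ∀ i ∈ s, 0 ≤ c i := fun i hi => hc i (Finset.mem_insert_of_mem hi)
      have ih' := ih hs
      have hsum : 0 ≤ ∑ i ∈ s, c i := Finset.sum_nonneg hs
      nlinarith

omit [DecidableEq X] [NeZero L₀] in
/-- **Domination**: `(1 + K(k)/J)^{2L₀} ≤ gDom(k)`. [folklore] -/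
theorem one_add_Ksum_div_pow_le_gDom (J : NNReal) (k : CIdx X L₀ N → ℝ × ℝ) :
    (1 + Ksum k / J) ^ (2 * L₀) ≤ gDom J L₀ k := by
  unfold gDom Ksum
  have h1 : 1 + (∑ ι, ‖kapz (k ι)‖) / J ≤ ∏ ι : CIdx X L₀ N, (1 + ‖kapz (k ι)‖ / J) := by
    rw [Finset.sum_div]
    exact one_add_sum_le_prod_one_add _ fun ι _ => by positivity
  calc (1 + (∑ ι, ‖kapz (k ι)‖) / ↑J) ^ (2 * L₀)
      ≤ (∏ ι : CIdx X L₀ N, (1 + ‖kapz (k ι)‖ / J)) ^ (2 * L₀) :=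
        pow_le_pow_left₀ (by positivity) h1 _
    _ = ∏ ι : CIdx X L₀ N, (1 + ‖kapz (k ι)‖ / J) ^ (2 * L₀) := (Finset.prod_pow _ _ _).symm
    _ ≤ ∏ ι, dom₂ J (2 * L₀) (k ι) :=
        Finset.prod_le_prod (fun ι _ => by positivity) fun ι _ => one_add_norm_kapz_div_pow_le J _ _

omit [DecidableEq X] [NeZero L₀] in
/-- **The Gram integrand is dominated**: for fields with entries bounded by `1`,
`|conj r_k(a) r_k(b)| ≤ C_h² N^{2L₀} gDom(k)`, an integrable function of `k`. [folklore] -/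
theorem norm_conj_rker_mul_rker_le (J : NNReal) (h : X → ℂ) {a b : MField X L₀ N}
    (ha : ∀ x t e e', ‖a x t e e'‖ ≤ 1) (hb : ∀ x t e e', ‖b x t e e'‖ ≤ 1) (k : CIdx X L₀ N → ℝ × ℝ) :
    ‖conj (rker J h k a) * rker J h k b‖ ≤
      ((2 * N * ∑ x, ‖h x‖) * N ^ L₀) ^ 2 * gDom J L₀ k := by
  rw [norm_mul, Complex.norm_conj]
  have hK : 0 ≤ 1 + Ksum k / J := by have := Ksum_nonneg k; positivity
  have hC : 0 ≤ (2 * N * ∑ x, ‖h x‖) := by positivity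
  have h1 := norm_rker_le J h ha k
  have h2 := norm_rker_le J h hb k
  calc ‖rker J h k a‖ * ‖rker J h k b‖
      ≤ ((2 * N * ∑ x, ‖h x‖) * (N * (1 + Ksum k / J)) ^ L₀) ^ 2 := by
        rw [sq]; exact mul_le_mul h1 h2 (norm_nonneg _) (by positivity)
    _ = ((2 * N * ∑ x, ‖h x‖) * N ^ L₀) ^ 2 * (1 + Ksum k / J) ^ (2 * L₀) := by
        rw [mul_pow (N : ℝ) (1 + Ksum k / J) L₀, mul_comm 2 L₀, pow_mul]; ring
    _ ≤ ((2 * N * ∑ x, ‖h x‖) * N ^ L₀) ^ 2 * gDom J L₀ k :=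
        mul_le_mul_of_nonneg_left (one_add_Ksum_div_pow_le_gDom J k) (by positivity)

end Bounds

section Continuity

variable {X : Type*} [Fintype X] [DecidableEq X] {L₀ N : ℕ} [NeZero L₀]

omit [NeZero L₀] in
/-- The loop function is continuous. [folklore] -/
theorem continuous_loopTr : Continuous (loopTr : (Fin L₀ → Matrix (Fin N) (Fin N) ℂ) → ℂ) :=
  (Continuous.matrix_trace continuous_id).comp continuous_cycProd

attribute [fun_prop] continuous_loopTr

omit [Fintype X] [DecidableEq X] [NeZero L₀] in
/-- Joint continuity of `(k, b) ↦ R_x(k, b)`. [folklore] -/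
theorem continuous_Rsite (J : NNReal) (x : X) :
    Continuous fun p : (CIdx X L₀ N → ℝ × ℝ) × MField X L₀ N => Rsite J p.1 p.2 x := by
  unfold Rsite kapM
  fun_prop

omit [DecidableEq X] [NeZero L₀] in
/-- Joint continuity of `(k, b) ↦ ⟨k, b⟩`. [folklore] -/
theorem continuous_rin : Continuous fun p : (CIdx X L₀ N → ℝ × ℝ) × MField X L₀ N => rin p.1 p.2 := by
  unfold rin MField.entry
  refine continuous_finsetSum _ fun ι _ => ?_
  have hk : Continuous fun p : (CIdx X L₀ N → ℝ × ℝ) × MField X L₀ N => p.1 ι :=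
    (continuous_apply ι).comp continuous_fst
  have hb : Continuous fun p : (CIdx X L₀ N → ℝ × ℝ) × MField X L₀ N => p.2 ι.1 ι.2.1 ι.2.2.1 ι.2.2.2 :=
    (continuous_apply _).comp ((continuous_apply _).comp ((continuous_apply _).comp
      ((continuous_apply _).comp continuous_snd)))
  exact ((continuous_fst.comp hk).mul (Complex.continuous_re.comp hb)).add
    ((continuous_snd.comp hk).mul (Complex.continuous_im.comp hb))

omit [DecidableEq X] [NeZero L₀] in
/-- **Joint continuity of the Gram feature** `(k, b) ↦ r_k(b)`. [folklore] -/
theorem continuous_rker (J : NNReal) (h : X → ℂ) :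
    Continuous fun p : (CIdx X L₀ N → ℝ × ℝ) × MField X L₀ N => rker J h p.1 p.2 := by
  unfold rker Rsum
  refine (Complex.continuous_exp.comp ((continuous_const.mul
    (Complex.continuous_ofReal.comp continuous_rin)).neg)).mul ?_
  exact continuous_finsetSum _ fun x _ => continuous_const.mul (continuous_Rsite J x)

end Continuity

end Literature.Barriers.QuantumFields.InfraredGaussian

end
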